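import Literature.AnabelianGeometry.AbsoluteAnabelian.MLFGaloisTMIsoUnitsTransport
import Literature.AnabelianGeometry.AbsoluteAnabelian.GaloisCyclotomeTransportNaturalityAnyData
import HarnessLib

/-!
# [AbsTopIII] Prop 3.2 (ii) with `μ_Ẑ(G)`-coefficients: CANONICITY of the Kummer maps `M^H_TM → H¹(H, μ_Ẑ(G))`
# along isomorphisms of MLF-Galois `TM`-pairs — presentation-independence across base fields

S. Mochizuki, *Topics in Absolute Anabelian Geometry III*, §3 (bib key `MochizukiAbsTopIII2015`; kurims
manuscript pages, lit key `paper:url-5493eb38cbb7`): Prop. 3.2 preamble p. 71 l. 15–17 («functorial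
algorithms … relative to `𝒞^MLF_T`»), Prop. 3.2 (ii) p. 71 l. 61 – p. 72 l. 6 («we obtain a functorial
algorithm for constructing … the Kummer maps `M^H_TM → H¹(H, μ_Ẑ(M_TM))` … where … the «`μ_Ẑ(M_TM)`» may
be replaced by «`μ_Ẑ(G)`» [cf. Remark 3.2.1 below]»), Rmk. 3.2.1 p. 73 («a functorial algorithm for
constructing the natural isomorphism `μ_Ẑ(M_TM) ⥲ μ_Ẑ(G)`»).

THE POINT (abc-iut cell, layer L4, row «P32ii-MUZHAT-PRESENTATION-INDEP», part 2 of 2; sub-DAG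
`plan/L4/SUBDAG-AbsTopIII-Prop32.md` row P32.ii.L11; L4-lead RULING #8c).  abc-iut-L4-t2's
`MonoidKummerGaloisCyclotome.lean` (p432641) constructs, for model data `(k, k̄, ε_k : Π_k ↠ G_k)` and a
torsion reciprocity datum `R`, the Kummer maps `κ^G_H : (𝒪_k̄^⊳)^H → H¹(H, μ_Ẑ(G_k))` with values in the
cohomology of the GROUP-THEORETIC cyclotome `μ_Ẑ(G_k)` (abc-iut-L4-t1), read through Rmk. 3.2.1
(`coeffIso : H¹(H, μ_Ẑ(G_k)) ≅ H¹(H, Λ(k̄ˣ))`); they depend on `R` exactly as print's «natural isomorphism»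
depends on local class field theory.  Print's functoriality («functorial algorithm») requires that along an
ISOMORPHISM OF PAIRS `f = (f_Π, f_M) : (Π₁ ↷ 𝒪_k̄₁^⊳) ⥲ (Π₂ ↷ 𝒪_k̄₂^⊳)` — two models over possibly
DIFFERENT base fields, e.g. two model presentations of one abstract MLF-Galois `TM`-pair — these maps
correspond under the PURELY GROUP-THEORETIC identification of their targets
`H¹(f_Π|, μ_Ẑ(ᾱ)) : H¹(H₁, μ_Ẑ(G_{k₁})) ⥲ H¹(H₂, μ_Ẑ(G_{k₂}))` (`ᾱ` the Galois isomorphism covered by `f_Π`,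
`μ_Ẑ(ᾱ) = muZhat.congr ᾱ`).  This holds for THE local-class-field-theory data
(`TorsionReciprocityData.fundamental`, abc-iut-w6-d022) — and fails for data of the two models chosen
independently (they differ from THE data by independent twists `u ∈ Ẑˣ`, `GaloisCyclotomeReciprocityTwist`).
Proved here, from part 1 (`MLFGaloisTMIsoUnitsTransport.lean`: `(ᾱ, f_M^gp)` is a units transport; the
coefficient square `cyclotome_map_rootsHom_muZhat_map`) and abc-iut-L4-t2's `Λ(k̄ˣ)`-valued naturality
`ModelMLFGaloisData.kummer_natural` (p429531):

* `GaloisMonoidPair.Iso.muZhatComparisonIso f R₁ R₂ hH hbij : H¹(H₁, μ_Ẑ(G_{k₁})) ≅ H¹(H₂, μ_Ẑ(G_{k₂}))` for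
  open `H₁ ⊆ Π₁`, `H₂ ⊆ Π₂` with `f_Π| : H₁ ⥲ H₂` — Mathlib `groupCohomology.mapIso` along `(f_Π|, μ_Ẑ(ᾱ))`,
  depending on `f` ONLY THROUGH `f_Π` and `ᾱ`;
* `muZhatComparisonIso_hom_comp_coeffIso_hom_comp_pullH1` — `H¹` of the coefficient square;
* **`GaloisMonoidPair.Iso.muZhatComparisonIso_kummerMuZhat`** (and `…_mapOpen` at `H₂ = f_Π(H₁)`) — for THE
  data: `H¹(f_Π|, μ_Ẑ(ᾱ)) (κ^G_{H₁}(m)) = κ^G_{H₂}(f_M m)`;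
* **`GaloisMonoidPair.ModelPresentation.muZhatCanonicalIso_kummerMuZhat`** — for two model presentations
  `π₁`, `π₂` of one ABSTRACT MLF-Galois `TM`-pair: the `μ_Ẑ(G)`-valued Kummer maps on abstract pairs
  (`ModelPresentation.kummerMuZhat`, p432641) are independent of the presentation up to the canonical,
  group-theoretic identification `muZhatCanonicalIso` of their targets — the `μ_Ẑ(G)`-coefficient twin of
  abc-iut-L4-t2's `canonicalEquiv_kummer` (p430541).

Small DATA definitions only (restriction isomorphism, coefficient isomorphism, the two comparison
isomorphisms); no `Prop`-valued definition, no instance.  Universe `0` (Mathlib `groupCohomology`).  HONEST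
FRAMING: classical Kummer theory and local class field theory as proved in the tree; nothing here bears on
[IUTchIII] Cor. 3.12; no side is taken; nothing asserts that abc is proved or refuted.
-/

noncomputable section

namespace Literature.AnabelianGeometry.AbsoluteAnabelian

open _root_.CategoryTheory groupCohomology Field
open Literature.AnabelianGeometry.EtaleTheta (EquivariantMorphism)

namespace GaloisMonoidPair.Iso

variable {C₁ C₂ : MLFClosure.{0}} {D₁ : ModelMLFGaloisData C₁.k C₁.K} {D₂ : ModelMLFGaloisData C₂.k C₂.K}
  (f : GaloisMonoidPair.Iso D₁.tmPair D₂.tmPair)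

/-! ### §4 The comparison `H¹(f_Π|, μ_Ẑ(ᾱ))` and the naturality of the `μ_Ẑ(G)`-valued Kummer maps -/

section Cohomology

variable (R₁ : TorsionReciprocityData C₁.k) (R₂ : TorsionReciprocityData C₂.k)
  {H₁ : OpenSubgroup D₁.tmPair.Pi} {H₂ : OpenSubgroup D₂.tmPair.Pi}
  (hH : (H₁ : Subgroup D₁.Pi).map f.isoPi.toMonoidHom ≤ (H₂ : Subgroup D₂.Pi))
  (hbij : Function.Bijective (f.unitsMorphism.groupHomRestrict hH))

/-- `f_Π| : H₁ ⥲ H₂` as a group isomorphism (for `f_Π(H₁) ⊆ H₂` with `f_Π|` bijective, e.g. `H₂ = f_Π(H₁)`).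
[cite: MochizukiAbsTopIII2015, Definition 3.1 (ii) p.67] -/
def restrictEquiv : (H₁ : Subgroup D₁.Pi) ≃* (H₂ : Subgroup D₂.Pi) :=
  MulEquiv.ofBijective (f.unitsMorphism.groupHomRestrict hH) hbij

/-- Values of `restrictEquiv`. [cite: MochizukiAbsTopIII2015, Definition 3.1 (ii) p.67] -/
@[simp] theorem coe_restrictEquiv_apply (g : (H₁ : Subgroup D₁.Pi)) :
    ((f.restrictEquiv hH hbij g : (H₂ : Subgroup D₂.Pi)) : D₂.Pi) = f.isoPi g := rfl

/-- **`μ_Ẑ(ᾱ)` on the coefficient carriers**: `μ_Ẑ(G_{k₁}) ⥲ μ_Ẑ(G_{k₂})` (`muZhat.congr ᾱ`) as a `ℤ`-linear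
isomorphism of the carriers of `μ_Ẑ(G_{k₁})|_{H₁}`, `μ_Ẑ(G_{k₂})|_{H₂}` — PURELY GROUP-THEORETIC in `ᾱ`.
[cite: MochizukiAbsTopIII2015, Proposition 3.2 (ii) p.72] -/
def muZhatCoeffEquiv :
    (ModelMLFGaloisData.muZhatRep C₁ D₁ R₁ (H₁ : Subgroup D₁.Pi)).V ≃ₗ[ℤ]
      (ModelMLFGaloisData.muZhatRep C₂ D₂ R₂ (H₂ : Subgroup D₂.Pi)).V :=
  (MulEquiv.toAdditive (muZhat.congr f.absGaloisIso)).toIntLinearEquiv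

/-- Values of `muZhatCoeffEquiv`: `μ_Ẑ(ᾱ)`. [cite: MochizukiAbsTopIII2015, Proposition 3.2 (ii) p.72] -/
theorem muZhatCoeffEquiv_apply (v : (ModelMLFGaloisData.muZhatRep C₁ D₁ R₁ (H₁ : Subgroup D₁.Pi)).V) :
    f.muZhatCoeffEquiv R₁ R₂ (H₁ := H₁) (H₂ := H₂) v =
      Additive.ofMul (muZhat.map f.absGaloisIso (Additive.toMul v)) := rfl

/-- `μ_Ẑ(ᾱ)` intertwines the `H₁`-action (through `augGal₁`) with the `H₂`-action (through `augGal₂`) along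
`f_Π|` (`muZhat.map_smul`, `ᾱ ∘ augGal₁ = augGal₂ ∘ f_Π`). [cite: MochizukiAbsTopIII2015, Proposition 3.2 (ii) p.72] -/
theorem muZhatCoeffEquiv_comm (g : (H₁ : Subgroup D₁.Pi)) :
    (f.muZhatCoeffEquiv R₁ R₂ (H₁ := H₁) (H₂ := H₂)).toLinearMap ∘ₗ
        (ModelMLFGaloisData.muZhatRep C₁ D₁ R₁ (H₁ : Subgroup D₁.Pi)).ρ g =
      (ModelMLFGaloisData.muZhatRep C₂ D₂ R₂ (H₂ : Subgroup D₂.Pi)).ρ (f.restrictEquiv hH hbij g) ∘ₗ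
        (f.muZhatCoeffEquiv R₁ R₂ (H₁ := H₁) (H₂ := H₂)).toLinearMap := by
  refine LinearMap.ext fun v => ?_
  change Additive.ofMul (muZhat.map f.absGaloisIso
      (D₁.augGal C₁ (g : D₁.Pi) • (Additive.toMul v : muZhat (absoluteGaloisGroup C₁.k)))) =
    Additive.ofMul (D₂.augGal C₂ (f.isoPi (g : D₁.Pi)) •
      muZhat.map f.absGaloisIso (Additive.toMul v : muZhat (absoluteGaloisGroup C₁.k)))
  rw [muZhat.map_smul, absGaloisIso_augGal]

/-- **The comparison isomorphism `H¹(f_Π|, μ_Ẑ(ᾱ)) : H¹(H₁, μ_Ẑ(G_{k₁})) ⥲ H¹(H₂, μ_Ẑ(G_{k₂}))`** (Mathlib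
`groupCohomology.mapIso` along the group isomorphism `f_Π| : H₁ ⥲ H₂` and the coefficient isomorphism
`μ_Ẑ(ᾱ)`); it depends on `f` only through `f_Π` and the covered `ᾱ` — the «evident» functoriality of the
targets of the `μ_Ẑ(G)`-valued Kummer maps. [cite: MochizukiAbsTopIII2015, Proposition 3.2 (ii) p.72] -/
def muZhatComparisonIso :
    groupCohomology.H1 (ModelMLFGaloisData.muZhatRep C₁ D₁ R₁ (H₁ : Subgroup D₁.Pi)) ≅
      groupCohomology.H1 (ModelMLFGaloisData.muZhatRep C₂ D₂ R₂ (H₂ : Subgroup D₂.Pi)) :=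
  groupCohomology.mapIso (A := ModelMLFGaloisData.muZhatRep C₂ D₂ R₂ (H₂ : Subgroup D₂.Pi))
    (B := ModelMLFGaloisData.muZhatRep C₁ D₁ R₁ (H₁ : Subgroup D₁.Pi)) (f.restrictEquiv hH hbij)
    (f.muZhatCoeffEquiv R₁ R₂) (f.muZhatCoeffEquiv_comm R₁ R₂ hH hbij) 1

/-- **The square of comparisons commutes, given the coefficient square**: if Rmk. 3.2.1's identifications
built from `R₁`, `R₂` intertwine `μ_Ẑ(ᾱ)` with `Λ(f_M^gp)` (hypothesis `hsq`; for THE data: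
`cyclotome_map_rootsHom_muZhat_map`), then `H¹(f_Π|, μ_Ẑ(ᾱ))` followed by `H¹(H₂, Rmk. 3.2.1)` and the
pull-back `f_Π^*` equals `H¹(H₁, Rmk. 3.2.1)` followed by the push-forward `Λ(f_M^gp)_*` (functoriality of
Mathlib `groupCohomology.map`). [cite: MochizukiAbsTopIII2015, Remark 3.2.1 p.73] -/
theorem muZhatComparisonIso_hom_comp_coeffIso_hom_comp_pullH1
    (hsq : ∀ ζ : muZhat (absoluteGaloisGroup C₁.k),
      EtaleTheta.cyclotome.map (ModelMLFGaloisData.rootsHom C₂ R₂) (muZhat.map f.absGaloisIso ζ) =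
        EtaleTheta.cyclotome.map (ModelMLFGaloisData.unitsLift f.isoM.toMonoidHom)
          (EtaleTheta.cyclotome.map (ModelMLFGaloisData.rootsHom C₁ R₁) ζ)) :
    (f.muZhatComparisonIso R₁ R₂ hH hbij).hom ≫
        (ModelMLFGaloisData.coeffIso C₂ D₂ R₂ (H₂ : Subgroup D₂.Pi)).hom ≫ f.unitsMorphism.pullH1 hH =
      (ModelMLFGaloisData.coeffIso C₁ D₁ R₁ (H₁ : Subgroup D₁.Pi)).hom ≫ f.unitsMorphism.pushH1 hH := by
  rw [ModelMLFGaloisData.coeffIso_hom, ModelMLFGaloisData.coeffIso_hom, muZhatComparisonIso,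
    groupCohomology.mapIso_hom, EquivariantMorphism.pullH1, EquivariantMorphism.pushH1,
    ← groupCohomology.map_comp, ← groupCohomology.map_comp, ← groupCohomology.map_id_comp]
  refine groupCohomology.map_congr ?_ ?_ 1
  · refine MonoidHom.ext fun x => ?_
    change (f.restrictEquiv hH hbij).symm (f.unitsMorphism.groupHomRestrict hH x) = x
    exact (f.restrictEquiv hH hbij).symm_apply_apply x
  · refine LinearMap.ext fun v => ?_
    change Additive.ofMul (EtaleTheta.cyclotome.map (ModelMLFGaloisData.rootsHom C₂ R₂)
          (muZhat.map f.absGaloisIso (Additive.toMul v))) =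
      Additive.ofMul (EtaleTheta.cyclotome.map (ModelMLFGaloisData.unitsLift f.isoM.toMonoidHom)
        (EtaleTheta.cyclotome.map (ModelMLFGaloisData.rootsHom C₁ R₁) (Additive.toMul v)))
    rw [hsq]
    rfl

/-- **Naturality of the `μ_Ẑ(G)`-valued Kummer maps, given the coefficient square.**  For an isomorphism
`f = (f_Π, f_M)` of model MLF-Galois `TM`-pairs, open `H₁ ⊆ Π₁`, `H₂ ⊆ Π₂` with `f_Π| : H₁ ⥲ H₂`, data
`R₁`, `R₂` satisfying the coefficient square `hsq`, and `m ∈ (𝒪_k̄₁^⊳)^{H₁}`: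
`H¹(f_Π|, μ_Ẑ(ᾱ)) (κ^G_{H₁}(m)) = κ^G_{H₂}(f_M m)` — from abc-iut-L4-t2's `Λ(k̄ˣ)`-valued naturality
`ModelMLFGaloisData.kummer_natural` (p429531) and the injectivity of `f_Π^*`.
[cite: MochizukiAbsTopIII2015, Proposition 3.2 (ii) p.72] -/
theorem muZhatComparisonIso_kummerMuZhat_of_square
    (hsq : ∀ ζ : muZhat (absoluteGaloisGroup C₁.k),
      EtaleTheta.cyclotome.map (ModelMLFGaloisData.rootsHom C₂ R₂) (muZhat.map f.absGaloisIso ζ) =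
        EtaleTheta.cyclotome.map (ModelMLFGaloisData.unitsLift f.isoM.toMonoidHom)
          (EtaleTheta.cyclotome.map (ModelMLFGaloisData.rootsHom C₁ R₁) ζ))
    (m : {m : D₁.tmPair.M // ∀ h : H₁, (h : D₁.tmPair.Pi) • m = m})
    (hm : ∀ h : H₂, (h : D₂.tmPair.Pi) • f.isoM m.1 = f.isoM m.1) :
    (f.muZhatComparisonIso R₁ R₂ hH hbij).hom (ModelMLFGaloisData.kummerMuZhat C₁ D₁ R₁ H₁ m) =
      ModelMLFGaloisData.kummerMuZhat C₂ D₂ R₂ H₂ ⟨f.isoM m.1, hm⟩ := by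
  set I := f.muZhatComparisonIso R₁ R₂ hH hbij
  set e₁ := ModelMLFGaloisData.coeffIso C₁ D₁ R₁ (H₁ : Subgroup D₁.Pi)
  set e₂ := ModelMLFGaloisData.coeffIso C₂ D₂ R₂ (H₂ : Subgroup D₂.Pi)
  -- the `Λ(k̄ˣ)`-valued naturality of the model Kummer maps (p429531)
  have hnat := ModelMLFGaloisData.kummer_natural f.isoPi.toMonoidHom f.isoM.toMonoidHom f.smul_comm H₁ H₂ hH m hm
  -- the square of comparisons, evaluated at `κ^G_{H₁}(m) = e₁⁻¹ κ_{H₁}(m)`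
  have hsq' := congrArg (fun φ => φ (ModelMLFGaloisData.kummerMuZhat C₁ D₁ R₁ H₁ m))
    (congrArg (fun φ => (φ : _ ⟶ _)) (f.muZhatComparisonIso_hom_comp_coeffIso_hom_comp_pullH1 R₁ R₂ hH hbij hsq))
  simp only [ModuleCat.hom_comp, LinearMap.coe_comp, Function.comp_apply] at hsq'
  change f.unitsMorphism.pullH1 hH (e₂.hom (I.hom _)) = f.unitsMorphism.pushH1 hH (e₁.hom _) at hsq'
  rw [ModelMLFGaloisData.coeffIso_hom_kummerMuZhat, ← hnat] at hsq'
  -- `f_Π^*` is injective (`f_Π|` is bijective)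
  haveI := f.unitsMorphism.isIso_pullH1 hH hbij
  have hinj : Function.Injective (f.unitsMorphism.pullH1 hH) :=
    (ConcreteCategory.bijective_of_isIso (f.unitsMorphism.pullH1 hH)).1
  have h2 : e₂.hom (I.hom (ModelMLFGaloisData.kummerMuZhat C₁ D₁ R₁ H₁ m)) =
      (D₂.kummerTheory C₂).kummer H₂ ⟨f.isoM m.1, hm⟩ := hinj hsq'
  have h3 := congrArg e₂.inv h2
  rw [Iso.hom_inv_id_apply] at h3
  exact h3

/-- **[AbsTopIII] Prop 3.2 (ii) with `μ_Ẑ(G)`-coefficients: NATURALITY along an isomorphism of model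
`TM`-pairs, across base fields, for THE reciprocity data.**  For an isomorphism
`f = (f_Π, f_M) : (Π₁ ↷ 𝒪_k̄₁^⊳) ⥲ (Π₂ ↷ 𝒪_k̄₂^⊳)` of model MLF-Galois `TM`-pairs, open `H₁ ⊆ Π₁`, `H₂ ⊆ Π₂`
with `f_Π| : H₁ ⥲ H₂`, and `m ∈ (𝒪_k̄₁^⊳)^{H₁}`: `H¹(f_Π|, μ_Ẑ(ᾱ)) (κ^G_{H₁}(m)) = κ^G_{H₂}(f_M m)`, the
`μ_Ẑ(G)`-valued Kummer maps being built from THE local-class-field-theory data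
(`TorsionReciprocityData.fundamental`).  The identification of the targets is purely group-theoretic; the
`μ_Ẑ(G)`-valued Kummer map is thus an invariant of the ISOMORPHISM CLASS of the pair — «a functorial
algorithm … where … «`μ_Ẑ(M_TM)`» may be replaced by «`μ_Ẑ(G)`»».
[cite: MochizukiAbsTopIII2015, Proposition 3.2 (ii) p.72] -/
theorem muZhatComparisonIso_kummerMuZhat (m : {m : D₁.tmPair.M // ∀ h : H₁, (h : D₁.tmPair.Pi) • m = m})
    (hm : ∀ h : H₂, (h : D₂.tmPair.Pi) • f.isoM m.1 = f.isoM m.1) :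
    (f.muZhatComparisonIso (TorsionReciprocityData.fundamental C₁.k) (TorsionReciprocityData.fundamental C₂.k)
        hH hbij).hom
        (ModelMLFGaloisData.kummerMuZhat C₁ D₁ (TorsionReciprocityData.fundamental C₁.k) H₁ m) =
      ModelMLFGaloisData.kummerMuZhat C₂ D₂ (TorsionReciprocityData.fundamental C₂.k) H₂ ⟨f.isoM m.1, hm⟩ :=
  f.muZhatComparisonIso_kummerMuZhat_of_square _ _ hH hbij f.cyclotome_map_rootsHom_muZhat_map m hm

end Cohomology

/-! ### §4b The case `H₂ = f_Π(H₁)` -/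

/-- `f_Π| : H₁ → f_Π(H₁)` is bijective. [cite: MochizukiAbsTopIII2015, Definition 3.1 (ii) p.67] -/
theorem groupHomRestrict_mapOpen_bijective (H₁ : OpenSubgroup D₁.tmPair.Pi) :
    Function.Bijective (f.unitsMorphism.groupHomRestrict (H₂ := (f.mapOpen H₁ : Subgroup D₂.Pi)) le_rfl) := by
  constructor
  · intro x y hxy
    apply Subtype.ext
    exact f.isoPi.injective (congrArg (fun z : (f.mapOpen H₁ : Subgroup D₂.Pi) => (z : D₂.Pi)) hxy)
  · rintro ⟨_, x, hx, rfl⟩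
    exact ⟨⟨x, hx⟩, rfl⟩

/-- **Naturality at `H₂ = f_Π(H₁)`**: for every open `H₁ ⊆ Π₁` and `m ∈ (𝒪_k̄₁^⊳)^{H₁}`,
`H¹(f_Π|, μ_Ẑ(ᾱ)) (κ^G_{H₁}(m)) = κ^G_{f_Π H₁}(f_M m)` (THE data on both sides).
[cite: MochizukiAbsTopIII2015, Proposition 3.2 (ii) p.72] -/
theorem muZhatComparisonIso_kummerMuZhat_mapOpen (H₁ : OpenSubgroup D₁.tmPair.Pi)
    (m : {m : D₁.tmPair.M // ∀ h : H₁, (h : D₁.tmPair.Pi) • m = m}) :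
    (f.muZhatComparisonIso (TorsionReciprocityData.fundamental C₁.k) (TorsionReciprocityData.fundamental C₂.k)
        (H₂ := f.mapOpen H₁) le_rfl (f.groupHomRestrict_mapOpen_bijective H₁)).hom
        (ModelMLFGaloisData.kummerMuZhat C₁ D₁ (TorsionReciprocityData.fundamental C₁.k) H₁ m) =
      ModelMLFGaloisData.kummerMuZhat C₂ D₂ (TorsionReciprocityData.fundamental C₂.k) (f.mapOpen H₁)
        ⟨f.isoM m.1, by
          rintro ⟨_, h₁, hh₁, rfl⟩
          exact f.smul_isoM_of_mem m.1 m.2 h₁ hh₁⟩ :=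
  f.muZhatComparisonIso_kummerMuZhat le_rfl (f.groupHomRestrict_mapOpen_bijective H₁) m _

/-! ### §4c One closure, ANY reciprocity datum -/

section SameClosure

variable {C : MLFClosure.{0}} {D₁ D₂ : ModelMLFGaloisData C.k C.K} (f : GaloisMonoidPair.Iso D₁.tmPair D₂.tmPair)
  (R : TorsionReciprocityData C.k)

/-- **The coefficient square over ONE closure holds for EVERY datum** (used on both sides): two model pairs
`(Π₁ ↷ 𝒪_k̄^⊳)`, `(Π₂ ↷ 𝒪_k̄^⊳)` over the same `(k, k̄)` and an isomorphism `f` between them; the `Ẑˣ`-twist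
of `R` against THE datum is invisible (abc-iut-L6-t11's `muZhatEquiv_congr_natural`, every `D`, every
topological automorphism of `G_k`). [cite: MochizukiAbsTopIII2015, Remark 3.2.1 p.73] -/
theorem cyclotome_map_rootsHom_muZhat_map_of_sameClosure (ζ : muZhat (absoluteGaloisGroup C.k)) :
    EtaleTheta.cyclotome.map (ModelMLFGaloisData.rootsHom C R) (muZhat.map f.absGaloisIso ζ) =
      EtaleTheta.cyclotome.map (ModelMLFGaloisData.unitsLift f.isoM.toMonoidHom)
        (EtaleTheta.cyclotome.map (ModelMLFGaloisData.rootsHom C R) ζ) := by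
  have key := TorsionReciprocityData.muZhatEquiv_congr_natural R f.absGaloisIso f.unitsAlgClosure
    f.isAlphaEquivariant f.preservesUniformizers ζ
  rw [muZhat.coe_congr] at key
  rw [ModelMLFGaloisData.map_rootsHom_eq, ModelMLFGaloisData.map_rootsHom_eq, key,
    EtaleTheta.cyclotome.map_map, EtaleTheta.cyclotome.map_map]
  have hφ : (Units.map (C.toAlgClosure.symm : AlgebraicClosure C.k →* C.K)).comp f.unitsAlgClosure.toMonoidHom =
      (ModelMLFGaloisData.unitsLift f.isoM.toMonoidHom).comp
        (Units.map (C.toAlgClosure.symm : AlgebraicClosure C.k →* C.K)) :=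
    MonoidHom.ext fun x => f.map_toAlgClosure_symm_unitsAlgClosure x
  rw [hφ]

/-- **Naturality over ONE closure for ANY datum**: for `f : (Π₁ ↷ 𝒪_k̄^⊳) ⥲ (Π₂ ↷ 𝒪_k̄^⊳)` over the same
`(k, k̄)`, every `R : TorsionReciprocityData k`, open `H₁`, `H₂` with `f_Π| : H₁ ⥲ H₂` and `m ∈ (𝒪_k̄^⊳)^{H₁}`:
`H¹(f_Π|, μ_Ẑ(ᾱ)) (κ^G_{H₁}(m)) = κ^G_{H₂}(f_M m)` with `R` on both sides — in particular the
`μ_Ẑ(G)`-valued Kummer maps of ONE model (p432641, any `R`) are natural under all automorphisms of the pair.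
[cite: MochizukiAbsTopIII2015, Proposition 3.2 (ii) p.72] -/
theorem muZhatComparisonIso_kummerMuZhat_of_sameClosure {H₁ : OpenSubgroup D₁.tmPair.Pi}
    {H₂ : OpenSubgroup D₂.tmPair.Pi} (hH : (H₁ : Subgroup D₁.Pi).map f.isoPi.toMonoidHom ≤ (H₂ : Subgroup D₂.Pi))
    (hbij : Function.Bijective (f.unitsMorphism.groupHomRestrict hH))
    (m : {m : D₁.tmPair.M // ∀ h : H₁, (h : D₁.tmPair.Pi) • m = m})
    (hm : ∀ h : H₂, (h : D₂.tmPair.Pi) • f.isoM m.1 = f.isoM m.1) :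
    (f.muZhatComparisonIso R R hH hbij).hom (ModelMLFGaloisData.kummerMuZhat C D₁ R H₁ m) =
      ModelMLFGaloisData.kummerMuZhat C D₂ R H₂ ⟨f.isoM m.1, hm⟩ :=
  f.muZhatComparisonIso_kummerMuZhat_of_square R R hH hbij (f.cyclotome_map_rootsHom_muZhat_map_of_sameClosure R)
    m hm

end SameClosure

end GaloisMonoidPair.Iso

/-! ### §5 Abstract MLF-Galois `TM`-pairs: presentation-independence of the `μ_Ẑ(G)`-valued Kummer maps -/

namespace GaloisMonoidPair.ModelPresentation

variable {P : GaloisMonoidPair.{0}} (π₁ π₂ : P.ModelPresentation) (H : OpenSubgroup P.Pi)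

/-- **The canonical identification of the targets of the `μ_Ẑ(G)`-valued Kummer maps of two presentations**
`π₁ = (k₁, e₁)`, `π₂ = (k₂, e₂)` of one abstract pair `(Π ↷ M)`:
`H¹(e₁⁻¹H, μ_Ẑ(G_{k₁})) ≅ H¹(e₂⁻¹H, μ_Ẑ(G_{k₂}))` along the change of presentation `e₂⁻¹ e₁` (p430541
`changeIso`) and its covered `ᾱ` — group-theoretic data only. [cite: MochizukiAbsTopIII2015, Proposition 3.2 (ii) p.72] -/
def muZhatCanonicalIso (R₁ : TorsionReciprocityData π₁.C.k) (R₂ : TorsionReciprocityData π₂.C.k) :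
    groupCohomology.H1 (ModelMLFGaloisData.muZhatRep π₁.C π₁.D R₁
        ((π₁.comapOpen H : OpenSubgroup π₁.D.tmPair.Pi) : Subgroup π₁.D.Pi)) ≅
      groupCohomology.H1 (ModelMLFGaloisData.muZhatRep π₂.C π₂.D R₂
        ((π₂.comapOpen H : OpenSubgroup π₂.D.tmPair.Pi) : Subgroup π₂.D.Pi)) :=
  (changeIso π₁ π₂).muZhatComparisonIso R₁ R₂ (map_changeIso_le π₁ π₂ H) (changeIso_restrict_bijective π₁ π₂ H)

/-- **PRESENTATION-INDEPENDENCE of the `μ_Ẑ(G)`-valued Kummer maps of [AbsTopIII] Prop 3.2 (ii) on an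
abstract MLF-Galois `TM`-pair, across base fields.**  For two model presentations `π₁`, `π₂` of `(Π ↷ M)`
(models over `k₁`, `k₂`), every open `H ⊆ Π` and every `m ∈ M^H`, the canonical identification of the
targets takes `π₁.kummerMuZhat` to `π₂.kummerMuZhat` (both built from THE reciprocity data):
`muZhatCanonicalIso (κ^{G,(1)}_H(m)) = κ^{G,(2)}_H(m)` — the `μ_Ẑ(G)`-coefficient twin of
`canonicalEquiv_kummer`. [cite: MochizukiAbsTopIII2015, Proposition 3.2 (ii) p.72] -/
theorem muZhatCanonicalIso_kummerMuZhat (m : {m : P.M // ∀ h : H, (h : P.Pi) • m = m}) :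
    (muZhatCanonicalIso π₁ π₂ H (TorsionReciprocityData.fundamental π₁.C.k)
        (TorsionReciprocityData.fundamental π₂.C.k)).hom
        (π₁.kummerMuZhat (TorsionReciprocityData.fundamental π₁.C.k) H m) =
      π₂.kummerMuZhat (TorsionReciprocityData.fundamental π₂.C.k) H m := by
  rw [muZhatCanonicalIso, kummerMuZhat, kummerMuZhat,
    (changeIso π₁ π₂).muZhatComparisonIso_kummerMuZhat (map_changeIso_le π₁ π₂ H)
      (changeIso_restrict_bijective π₁ π₂ H) _ (fun h => by
        rw [changeIso_isoM_apply, MulEquiv.apply_symm_apply]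
        exact π₂.iso.smul_symm_eq_of_mem_comap m.2 h)]
  congr 1
  apply Subtype.ext
  change π₂.iso.isoM.symm (π₁.iso.isoM (π₁.iso.isoM.symm m.1)) = π₂.iso.isoM.symm m.1
  rw [MulEquiv.apply_symm_apply]

end GaloisMonoidPair.ModelPresentation


end Literature.AnabelianGeometry.AbsoluteAnabelian

end
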